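import Mathlib

/-!
# The frozen geometric-optics cocycle preserves `det[k, b₁, b₂]` (solo soloist, blind mode)

Kinematic lemma behind the tuning equation of the steady two-scale ("SEIL") ansatz
`U = V + a·α(ψ) Re(B e^{iS/√ν})` for the zeroth law (HOME paper §23.2).

Along a trajectory `x(t)` of a steady incompressible carrier `V` (velocity gradient
`A i j = ∂ⱼ Vᵢ`, `tr A = div V = 0`) the frozen wave vector `k(t) = ∇S(x(t))` of a phase `S`
that is a first integral of `V` satisfies `k̇ = -Aᵀ k`, and the undamped amplitude of each
phase harmonic satisfies `ḃ = -A b + m k`, where the scalar multiplier `m` (for the actual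
cocycle `m = 2 (k·A b)/|k|²`) keeps `b ⊥ k`.  For ANY multipliers `m₁, m₂` and any two
amplitude vectors `b, c ⊥ k` the scalar triple product `det[k, b, c]` has zero derivative:

`det[-Aᵀk, b, c] + det[k, -Ab + m₁k, c] + det[k, b, -Ac + m₂k]`
`= (ω·b)(k·c) - (ω·c)(k·b) - (tr A)·det[k,b,c]`,  `ω = (A₃₂-A₂₃, A₁₃-A₃₁, A₂₁-A₁₂) = curl V`,

which vanishes when `tr A = 0` and `k·b = k·c = 0` (`cocycle_triple_rate_eq_zero`).  Consequently
(`cocycle_triple_conserved`) `det[k(t), b(t), c(t)]` is constant along solutions, so the monodromy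
of the undamped cocycle on the plane `k^⊥` over a closed streamline has determinant `1`
(`|k|` returns to its initial value): its Floquet multipliers are `μ, 1/μ`, and neutrality of the
damped cocycle `ḃ = -Ab + m k - |k|² b` is the single scalar condition
`log μ_max = ∫₀ᵀ |k|² dt` used in §23.2.  Pure linear algebra / one-variable calculus; no
fluid-mechanical input beyond the two displayed ODEs.
-/

namespace Summit.AnomalousDissipation.AnomalousDissipation.Theorems

open scoped BigOperators

/-- scalar triple product `det[x, y, z]` on `Fin 3 → ℝ` -/
def triple3 (x y z : Fin 3 → ℝ) : ℝ :=
  x 0 * (y 1 * z 2 - y 2 * z 1) - x 1 * (y 0 * z 2 - y 2 * z 0) + x 2 * (y 0 * z 1 - y 1 * z 0)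

/-- `A x` for a `3 × 3` real matrix given as `Fin 3 → Fin 3 → ℝ` -/
def mulVec3 (A : Fin 3 → Fin 3 → ℝ) (x : Fin 3 → ℝ) : Fin 3 → ℝ := fun i => ∑ j, A i j * x j

/-- `Aᵀ x` -/
def mulVecT3 (A : Fin 3 → Fin 3 → ℝ) (x : Fin 3 → ℝ) : Fin 3 → ℝ := fun i => ∑ j, A j i * x j

/-- Euclidean dot product on `Fin 3 → ℝ` -/
def dot3 (x y : Fin 3 → ℝ) : ℝ := ∑ i, x i * y i

/-- trace of a `3 × 3` matrix -/
def trace3 (A : Fin 3 → Fin 3 → ℝ) : ℝ := A 0 0 + A 1 1 + A 2 2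

/-- `ω · b` with `ω = (A₃₂ - A₂₃, A₁₃ - A₃₁, A₂₁ - A₁₂)` the vorticity vector of the gradient `A i j = ∂ⱼVᵢ` -/
def vortDot3 (A : Fin 3 → Fin 3 → ℝ) (b : Fin 3 → ℝ) : ℝ :=
  (A 2 1 - A 1 2) * b 0 + (A 0 2 - A 2 0) * b 1 + (A 1 0 - A 0 1) * b 2

/-- The rate of change of `det[k, b, c]` under `k̇ = -Aᵀk`, `ḃ = -Ab + m₁k`, `ċ = -Ac + m₂k`,
in closed form: `(ω·b)(k·c) - (ω·c)(k·b) - (tr A) det[k,b,c]`.  (Polynomial identity.) -/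
theorem cocycle_triple_rate_eq (A : Fin 3 → Fin 3 → ℝ) (k b c : Fin 3 → ℝ) (m₁ m₂ : ℝ) :
    triple3 (-(mulVecT3 A k)) b c + triple3 k (-(mulVec3 A b) + m₁ • k) c
        + triple3 k b (-(mulVec3 A c) + m₂ • k)
      = vortDot3 A b * dot3 k c - vortDot3 A c * dot3 k b - trace3 A * triple3 k b c := by
  simp only [triple3, mulVec3, mulVecT3, dot3, trace3, vortDot3, Fin.sum_univ_three, Pi.add_apply,
    Pi.neg_apply, Pi.smul_apply, smul_eq_mul]
  ring

/-- For a trace-free gradient and amplitudes transversal to `k`, `det[k, b, c]` has zero rate. -/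
theorem cocycle_triple_rate_eq_zero (A : Fin 3 → Fin 3 → ℝ) (k b c : Fin 3 → ℝ) (m₁ m₂ : ℝ)
    (htr : trace3 A = 0) (hb : dot3 k b = 0) (hc : dot3 k c = 0) :
    triple3 (-(mulVecT3 A k)) b c + triple3 k (-(mulVec3 A b) + m₁ • k) c
        + triple3 k b (-(mulVec3 A c) + m₂ • k) = 0 := by
  rw [cocycle_triple_rate_eq, htr, hb, hc]
  ring

/-- Conservation of `det[k, b, c]` along solutions of the frozen cocycle with a time-dependent
trace-free gradient `A t` (the carrier gradient seen along the streamline) and arbitrary scalar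
multipliers `m₁ t, m₂ t`, provided the amplitudes stay transversal to `k` (which the actual
multiplier `2(k·Ab)/|k|²` guarantees; here it is a hypothesis). -/
theorem cocycle_triple_conserved (A : ℝ → Fin 3 → Fin 3 → ℝ) (m₁ m₂ : ℝ → ℝ)
    (K B C : ℝ → Fin 3 → ℝ)
    (hK : ∀ t, HasDerivAt K (-(mulVecT3 (A t) (K t))) t)
    (hB : ∀ t, HasDerivAt B (-(mulVec3 (A t) (B t)) + m₁ t • K t) t)
    (hC : ∀ t, HasDerivAt C (-(mulVec3 (A t) (C t)) + m₂ t • K t) t)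
    (htr : ∀ t, trace3 (A t) = 0) (hb : ∀ t, dot3 (K t) (B t) = 0)
    (hc : ∀ t, dot3 (K t) (C t) = 0) :
    ∀ s t, triple3 (K s) (B s) (C s) = triple3 (K t) (B t) (C t) := by
  -- derivative of the triple product along the flow, in product-rule form
  have hD : ∀ t, HasDerivAt (fun t => triple3 (K t) (B t) (C t))
      (triple3 (-(mulVecT3 (A t) (K t))) (B t) (C t)
        + triple3 (K t) (-(mulVec3 (A t) (B t)) + m₁ t • K t) (C t)
        + triple3 (K t) (B t) (-(mulVec3 (A t) (C t)) + m₂ t • K t)) t := by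
    intro t
    have hK' : ∀ i, HasDerivAt (fun t => K t i) ((-(mulVecT3 (A t) (K t))) i) t :=
      fun i => (hasDerivAt_pi.1 (hK t)) i
    have hB' : ∀ i, HasDerivAt (fun t => B t i) ((-(mulVec3 (A t) (B t)) + m₁ t • K t) i) t :=
      fun i => (hasDerivAt_pi.1 (hB t)) i
    have hC' : ∀ i, HasDerivAt (fun t => C t i) ((-(mulVec3 (A t) (C t)) + m₂ t • K t) i) t :=
      fun i => (hasDerivAt_pi.1 (hC t)) i
    have h := (((hK' 0).mul (((hB' 1).mul (hC' 2)).sub ((hB' 2).mul (hC' 1)))).sub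
      ((hK' 1).mul (((hB' 0).mul (hC' 2)).sub ((hB' 2).mul (hC' 0))))).add
      ((hK' 2).mul (((hB' 0).mul (hC' 1)).sub ((hB' 1).mul (hC' 0))))
    have hfun : (fun t => triple3 (K t) (B t) (C t))
        = fun y => (K y 0 * (B y 1 * C y 2 - B y 2 * C y 1)
            - K y 1 * (B y 0 * C y 2 - B y 2 * C y 0))
            + K y 2 * (B y 0 * C y 1 - B y 1 * C y 0) := by
      funext y; simp only [triple3]
    rw [hfun]
    refine h.congr_deriv ?_
    simp only [triple3, Pi.add_apply, Pi.neg_apply, Pi.smul_apply, smul_eq_mul, Pi.mul_apply,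
      Pi.sub_apply]
    ring
  -- the rate vanishes identically
  have hD0 : ∀ t, HasDerivAt (fun t => triple3 (K t) (B t) (C t)) 0 t := fun t =>
    (hD t).congr_deriv (cocycle_triple_rate_eq_zero (A t) (K t) (B t) (C t) (m₁ t) (m₂ t)
      (htr t) (hb t) (hc t))
  have hdiff : Differentiable ℝ (fun t => triple3 (K t) (B t) (C t)) :=
    fun t => (hD0 t).differentiableAt
  have hder : ∀ t, deriv (fun t => triple3 (K t) (B t) (C t)) t = 0 := fun t => (hD0 t).deriv
  intro s t
  exact is_const_of_deriv_eq_zero hdiff hder s t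

end Summit.AnomalousDissipation.AnomalousDissipation.Theorems
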